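import Summits.CriticalPhenomena.SAWScalingLimit.Theorems.SAWLeftRightFKGFKGToTraversalBoundNecklaceAssemblyFarCascade
import Summits.CriticalPhenomena.SAWScalingLimit.Theorems.SAWLeftRightFKGFKGToTraversalBoundNecklaceBookkeeping
import HarnessLib

/-!
# Necklace assembly (far-tip form), part 5: the union bound at a fixed mesh

Crux `SAWLeftRightFKG.FKGToTraversalBound` (stmt-CriticalPhenomena-1878), line `slit-necklace`
(reshape r4), stub `stub_necklaceAssemblyFar`, steps A4–A5 of the chart
`Cruxes/FKGToTraversalBound/Lines/slit-necklace-chart-r4.md` §3, at ONE mesh `δ` with all data explicit.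

Claim (`necklace_badEvent_le`).  In the setting of `NecklaceBookkeeping` (blobs `Ka ∋ a₀`, `Kb ∋ b₀` within
`ιa, ιb < η` of the marked centres, defects `S`, `#S ≤ N₀`, a working shell `D(x; ρ_U, R_U)` whose `δ`-widened
closed band is `2η`-far from both centres) and of the cascade (`necklace_cascadeSelection`, p135280: scales
`s h`, nets `net h`, thresholds `n h`, lower budgets `Wf h`, witness budgets `K h`, levels `h ≤ H`,
`2 N₀ + 2 g ≤ H`), if for every chord with fewer than `2 N₀ + 2 g` far pieces a rank of height `≤ #far pieces` with the
far-tip witness property at every admissible cascade shell is available (hypothesis `hW` — the line's `NecklaceWitnessFar` in rank-uniform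
form, instantiated), then the law of "`2 (N₀ + 2g + (2N₀ + 2g) · N_H (n_H + 1) + 1)` separate traversals of the
working shell" is at most the law of the two germ events (`g` traversals of `D(ca; ιa, η)`, of `D(cb; ιb, η)`)
plus the sum over `h ≤ H`, centres `net h i₁` and `J < 2 N₀ + 2 g` of the laws of the SLOT-LAW events
(`SlotLaw` at `(y, ρ, R, s₁, s₂) := (net h i₁, s h, 2 s h, 21 s h / 16, 27 s h / 16)`, allowance `K h`).

Proof: pointwise, `stub_necklaceBookkeeping` (p130309) gives the germ alternatives or an overloaded far piece,
which `necklace_cascadeSelection` turns into membership of one slot-law event (`J` := the number of earlier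
far-tip pieces, `< 2 N₀ + 2 g` because far-tip pieces are far pieces); then `measure_union_le` /
`measure_biUnion_finset_le` / `measure_iUnion_fintype_le` on the discrete σ-algebra.

Only theorems; no named fact; axioms are the standard three.
-/

noncomputable section

open MeasureTheory Filter Topology Set Metric
open scoped NNReal ENNReal
open Literature.Probability.LatticeModels
open Literature.Probability.RandomPlanarGeometry
open Literature.Probability.RandomPlanarGeometry.SAW

namespace Summit.CriticalPhenomena.SAWScalingLimit.Theorems.FKGToTraversalBound.SlitNecklace

/-- **Registered part of `stub_necklaceAssemblyFar`: the union bound at a fixed mesh** (see the module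
docstring).  [folklore] -/
theorem necklace_badEvent_le : ∀ (Ω : Set ℂ) (δ : ℝ) (Ka Kb S : Finset (Site 2)) (a₀ b₀ : Site 2)
    (ca cb x : ℂ) (ιa ιb η ρU RU : ℝ) (g N₀ H : ℕ) (s : ℕ → ℝ) (N : ℕ → ℕ) (net : (h : ℕ) → Fin (N h) → ℂ)
    (n Wf K : ℕ → ℕ),
    0 < δ → a₀ ∈ Ka → b₀ ∈ Kb →
    (∀ k ∈ Ka, dist (meshPoint δ k) ca ≤ ιa) → (∀ k ∈ Kb, dist (meshPoint δ k) cb ≤ ιb) → S.card ≤ N₀ →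
    ιa < η → ιb < η → 2 * η + δ ≤ RU - ρU → RU ≤ 3 → 0 ≤ ρU →
    (∀ z : ℂ, ρU - δ ≤ dist z x → dist z x ≤ RU + δ → 2 * η ≤ dist z ca ∧ 2 * η ≤ dist z cb) →
    (∀ h, h ≤ H → 0 < s h) → (∀ h, h ≤ H → 32 * δ ≤ s h) →
    (∀ h, h < H → 5 * s h + 2 * δ ≤ s (h + 1) / 4) → 5 * s H + 4 * δ ≤ RU - ρU →
    (∀ h, h ≤ H → ∀ m : ℂ, dist m x ≤ 3 → ∃ i : Fin (N h), dist m (net h i) ≤ s h / 2) →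
    (∀ h, h < H → N h * (n h + 1) ≤ Wf (h + 1) + 1) → 2 * N₀ + 2 * g ≤ H →
    (∀ γ : DomainSAW Ω δ a₀ b₀,
      {i' : ℕ | ∃ j', IsFarPiece (meshPoint δ) γ.walk (↑(Ka ∪ Kb ∪ S)) (↑S) i' j' ca cb η}.ncard < 2 * N₀ + 2 * g →
      ∃ rk : ℕ → ℕ,
      (∀ i, rk i ≤ {i' : ℕ | ∃ j', IsFarPiece (meshPoint δ) γ.walk (↑(Ka ∪ Kb ∪ S)) (↑S) i' j' ca cb η}.ncard) ∧
      ∀ (h : ℕ) (i₁ : Fin (N h)) (i j τ τ' : ℕ), h ≤ H →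
        ρU + 2 * s h ≤ dist (net h i₁) x → dist (net h i₁) x ≤ RU - 2 * s h →
        IsFarTipPiece (meshPoint δ) γ.walk (↑(Ka ∪ Kb ∪ S)) i j τ τ' ca cb η →
        (∀ i' j', IsFarPiece (meshPoint δ) γ.walk (↑(Ka ∪ Kb ∪ S)) (↑S) i' j' ca cb η → rk i' < rk i →
          ¬ HasSepWindows (meshPoint δ) γ.walk (Wf h + 1) (i' + 1) (j' - 1) (net h i₁)
            (21 * s h / 16 + 2 * δ) (27 * s h / 16 - 2 * δ)) →
        HasFarTipWitness Ω δ (↑(Ka ∪ Kb ∪ S)) γ.walk τ τ' (K h) (net h i₁) (21 * s h / 16) (27 * s h / 16)) →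
    law Ω δ a₀ b₀ {γ | (polyline γ).HasTraversals
        (2 * (N₀ + 2 * g + (2 * N₀ + 2 * g) * (N H * (n H + 1)) + 1)) x ρU RU} ≤
      law Ω δ a₀ b₀ {γ | (polyline γ).HasTraversals g ca ιa η} +
      law Ω δ a₀ b₀ {γ | (polyline γ).HasTraversals g cb ιb η} +
      ∑ h ∈ Finset.range (H + 1), ∑ i₁ : Fin (N h), ∑ J ∈ Finset.range (2 * N₀ + 2 * g),
        law Ω δ a₀ b₀ {γ | ∃ i j τ τ' : ℕ,
          IsFarTipPiece (meshPoint δ) γ.walk (↑(Ka ∪ Kb ∪ S)) i j τ τ' ca cb η ∧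
          {i' : ℕ | i' < i ∧ ∃ j' τ₁ τ₁',
              IsFarTipPiece (meshPoint δ) γ.walk (↑(Ka ∪ Kb ∪ S)) i' j' τ₁ τ₁' ca cb η}.ncard = J ∧
          HasSepWindows (meshPoint δ) γ.walk (n h) τ τ' (net h i₁) (s h) (2 * s h) ∧
          HasFarTipWitness Ω δ (↑(Ka ∪ Kb ∪ S)) γ.walk τ τ' (K h) (net h i₁) (21 * s h / 16) (27 * s h / 16)} := by
  intro Ω δ Ka Kb S a₀ b₀ ca cb x ιa ιb η ρU RU g N₀ H s N net n Wf K hδ ha₀ hb₀ hKa hKb hS hιa hιb h2η hRU hρU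
    hfar hs hs32 hscale hsH hnet hWf hH hW
  classical
  -- names for the events
  set M := 2 * N₀ + 2 * g with hM
  set E : ℕ → (Σ h, Fin (N h)) → Set (DomainSAW Ω δ a₀ b₀) := fun J t => {γ | ∃ i j τ τ' : ℕ,
    IsFarTipPiece (meshPoint δ) γ.walk (↑(Ka ∪ Kb ∪ S)) i j τ τ' ca cb η ∧
    {i' : ℕ | i' < i ∧ ∃ j' τ₁ τ₁',
        IsFarTipPiece (meshPoint δ) γ.walk (↑(Ka ∪ Kb ∪ S)) i' j' τ₁ τ₁' ca cb η}.ncard = J ∧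
    HasSepWindows (meshPoint δ) γ.walk (n t.1) τ τ' (net t.1 t.2) (s t.1) (2 * s t.1) ∧
    HasFarTipWitness Ω δ (↑(Ka ∪ Kb ∪ S)) γ.walk τ τ' (K t.1) (net t.1 t.2) (21 * s t.1 / 16)
      (27 * s t.1 / 16)} with hE
  set Ga : Set (DomainSAW Ω δ a₀ b₀) := {γ | (polyline γ).HasTraversals g ca ιa η} with hGa
  set Gb : Set (DomainSAW Ω δ a₀ b₀) := {γ | (polyline γ).HasTraversals g cb ιb η} with hGb
  set T : Set (DomainSAW Ω δ a₀ b₀) :=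
    ⋃ h ∈ Finset.range (H + 1), ⋃ i₁ : Fin (N h), ⋃ J ∈ Finset.range M, E J ⟨h, i₁⟩ with hT
  have hη : 0 ≤ η := by
    have := hKa a₀ ha₀
    linarith [dist_nonneg (x := meshPoint δ a₀) (y := ca)]
  have hle : discreteDomainGraph Ω δ ≤ zdGraph 2 :=
    (discreteDomainGraph_le_meshGraph Ω δ).trans (meshGraph_le_zdGraph Ω δ)
  -- pointwise inclusion
  have hsub : {γ : DomainSAW Ω δ a₀ b₀ | (polyline γ).HasTraversals
      (2 * (N₀ + 2 * g + (2 * N₀ + 2 * g) * (N H * (n H + 1)) + 1)) x ρU RU} ⊆ (Ga ∪ Gb) ∪ T := by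
    intro γ hγ
    have hsH' := hs H le_rfl
    have hs32H := hs32 H le_rfl
    rcases stub_necklaceBookkeeping δ (discreteDomainGraph Ω δ) a₀ b₀ γ.walk Ka Kb S ca cb x ιa ιb ρU RU η g
        (N H * (n H + 1)) N₀ hle γ.isPath hδ ha₀ hb₀ hKa hKb hS hιa hιb h2η (by linarith)
        (fun z hz₁ hz₂ => hfar z (by linarith) (by linarith)) hγ with hA | hB | ⟨hcount, i₀, j₀, hfp₀, hw₀⟩
    · exact Or.inl (Or.inl hA)
    · exact Or.inl (Or.inr hB)
    · right
      obtain ⟨rk, hrk, hWγ⟩ := hW γ hcount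
      have hrkH : ∀ i, rk i ≤ H := fun i => by have := hrk i; omega
      obtain ⟨h, i₁, i, j, τ, τ', hhH, hft, hJ, hw, hwit⟩ := necklace_cascadeSelection Ω δ a₀ b₀ γ.walk
        (↑(Ka ∪ Kb ∪ S)) (↑S) ca cb x η ρU RU H M s N net n Wf K rk i₀ j₀ hδ hRU hρU
        (fun z hz₁ hz₂ => ⟨by linarith [(hfar z hz₁ hz₂).1], by linarith [(hfar z hz₁ hz₂).2]⟩)
        hs hs32 hscale hsH hnet hWf hrkH hcount hWγ hfp₀ (hw₀.of_le (Nat.le_succ _))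
      simp only [hT, Set.mem_iUnion, Finset.mem_range]
      exact ⟨h, Nat.lt_succ_of_le hhH, i₁, _, hJ, i, j, τ, τ', hft, rfl, hw.of_le (Nat.le_succ _), hwit⟩
  -- union bound
  calc law Ω δ a₀ b₀ {γ | (polyline γ).HasTraversals
          (2 * (N₀ + 2 * g + (2 * N₀ + 2 * g) * (N H * (n H + 1)) + 1)) x ρU RU}
      ≤ law Ω δ a₀ b₀ ((Ga ∪ Gb) ∪ T) := measure_mono hsub
    _ ≤ law Ω δ a₀ b₀ Ga + law Ω δ a₀ b₀ Gb + law Ω δ a₀ b₀ T :=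
        (measure_union_le _ _).trans (add_le_add (measure_union_le _ _) le_rfl)
    _ ≤ law Ω δ a₀ b₀ Ga + law Ω δ a₀ b₀ Gb +
        ∑ h ∈ Finset.range (H + 1), ∑ i₁ : Fin (N h), ∑ J ∈ Finset.range M, law Ω δ a₀ b₀ (E J ⟨h, i₁⟩) := by
        gcongr
        refine (measure_biUnion_finset_le _ _).trans (Finset.sum_le_sum fun h _ => ?_)
        refine (measure_iUnion_fintype_le _ _).trans (Finset.sum_le_sum fun i₁ _ => ?_)
        exact measure_biUnion_finset_le _ _

end Summit.CriticalPhenomena.SAWScalingLimit.Theorems.FKGToTraversalBound.SlitNecklace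

end
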